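import Summits.HodgeConjecture.HodgeConjecture.Cruxes.BlochSeedDiscOne.RingFiveEmpty
import Summits.HodgeConjecture.HodgeConjecture.Cruxes.BlochSeedDiscOne.IntegralityGap

/-!
# Leg A's fallback target is literally NONEX(14, 199, 8)  (strengthen g8, bookkeeping; evidence-grade, letters ≠ sheaves)

With `RingFiveEmpty.ringsEmpty_14_199_8_5` in the tree (gs-eng-2 g59, filed 2026-08-30), the director's fallback target
`DepthBound 14 199 8 5` (R19.392) is EQUIVALENT to the bare non-existence statement `IntegralityGap.Nonex 14 199 8`
of the widened (A4) road at `copies ≤ 199`, `rank ≥ 8`: forward by `a4_closed_of_depthBound_five`, backward vacuously.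
The same holds for every `c₀ ≥ 5` for which the ring is empty, and `DepthBound 14 199 8 3 → Nonex 14 199 8`.

Why this file exists: MEMO-12 (tree `STRENGTHEN-MEMO-12-RATIONAL-DESIGNS.md`) exhibits exact RATIONAL solutions of the
(A1) ∧ (A4) ∧ (μ ≠ 0) ∧ (copies, rank) = (199, 8) system with letters of co-level up to 14 (seven two-P-cell designs, also
passing colour-1's (A4♯)+(CONN)).  Hence neither `Nonex 14 199 8` nor — by this equivalence — `DepthBound 14 199 8 5` admits a
mass-linear proof (admissible functional ∕ LP dual ∕ Farkas ∕ ring certificate): any proof must use the integrality of the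
multiplicities.  Nothing here is a step toward HC ∕ HC_CM ∕ HC_AV ∕ 18881; it only pins down WHAT the remaining target is.
-/

namespace Summit.HodgeConjecture.HodgeConjecture.Cruxes.BlochSeedDiscOne.LegAIsNonex

open Summit.HodgeConjecture.HodgeConjecture.Cruxes.BlochSeedDiscOne.DepthBoundA4
open Summit.HodgeConjecture.HodgeConjecture.Cruxes.BlochSeedDiscOne.RingFiveEmpty
open Summit.HodgeConjecture.HodgeConjecture.Cruxes.BlochSeedDiscOne.IntegralityGap

/-- Non-existence makes every depth bound vacuous. -/
theorem depthBound_of_nonex (c₀ : ℤ) (hn : Nonex 14 199 8) : DepthBound 14 199 8 c₀ := by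
  intro D hA h1 h4 hμ hB hrk
  exact (hn D hA h1 h4 hμ hB hrk).elim

/-- Leg A's fallback target is literally NONEX(14,199,8). -/
theorem depthBound_five_iff_nonex : DepthBound 14 199 8 5 ↔ Nonex 14 199 8 := by
  constructor
  · intro hd D hA h1 h4 hμ hB hrk
    exact a4_closed_of_depthBound_five hd D hA h1 h4 hμ hB hrk
  · exact depthBound_of_nonex 5

/-- … and so is the original target `DepthBound 14 199 8 3` (one direction through `depthBound_five_of_three`). -/
theorem depthBound_three_iff_nonex : DepthBound 14 199 8 3 ↔ Nonex 14 199 8 := by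
  constructor
  · intro hd D hA h1 h4 hμ hB hrk
    exact a4_closed_of_depthBound_five (depthBound_five_of_three hd) D hA h1 h4 hμ hB hrk
  · exact depthBound_of_nonex 3

/-- Consequently the sparse / k-tops reductions of `IntegralityGap` also reach Leg A's target:
`SparseNonex 14 199 199 8 → DepthBound 14 199 8 5` and `KTops 95 → DepthBound 14 199 8 5`. -/
theorem depthBound_five_of_sparse (hs : SparseNonex 14 199 199 8) : DepthBound 14 199 8 5 :=
  depthBound_of_nonex 5 (nonex_of_sparse hs)

theorem depthBound_five_of_kTops (hk : KTops 95) : DepthBound 14 199 8 5 :=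
  depthBound_of_nonex 5 (nonex_of_kTops hk)

end Summit.HodgeConjecture.HodgeConjecture.Cruxes.BlochSeedDiscOne.LegAIsNonex
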